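import Summits.AtomisticToContinuum.Crystallization.Theorems.ChargedEnergyGapPassage
import Summits.AtomisticToContinuum.Crystallization.Theorems.ChargedEnergyGapSecondShellLabelled
import HarnessLib

/-!
# Charged energy gap — lens-3 g63, part P-Z₅b′: «6 × 109» — 654 DISTINCT SHELL SITES along every bulk–far segment

Cell `decomp-a2c`, seat lens-3, generation 63, part P-Z₅b′ (after P-Z₅b `ChargedEnergyGapPassage` and P-Z₅a‴ `ChargedEnergyGapSecondShellLabelled`).
ELEMENTARY·PROVED.  The finite source set of the purely geometric attribution scheme «6 × 109» (seat HANDOFF §J (J8)/(J8′)/(J8″)): on a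
`(lam ≤ 1/3, ℓ ≥ 3)`-labelled reference, along the segment from a bulk source `y` (`153 ≤ d(y, C)`; bulk sources have `d ≥ 160`) to a far
site `z` (`d(z, C) ≤ 84`) there are `k` passage points at the levels `L₀ + (66/5)·t` (intermediate values of the level), around each the
second census gives `109` distinct sites within `619/100` (`IsLabelledRef.exists_109_near_point`), and blocks at level spacing `66/5 >
2·619/100` are pairwise disjoint (`injective_of_separated_centres`) — ★★ `exists_blocks_109`: an injective family `Fin k × Fin 109 → P.points`.
At the record (`ϱ = 160`, `L₀ = 87`, `k = 6`, levels `87, 100.2, …, 153`): ★★ `exists_654_shell_sites_record` — `654` pairwise distinct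
sites, each within `619/100` of a segment point at a block level and each of profile weight strictly between `0` and `1` (its level lies in
`(80.81, 159.19) ⊂ (80, 160)`: `profileWeight_pos_lt_one_near_level'`), i.e. a shell / transition carrier when non-excised and an
(H)-candidate when excised — the multiplicity-free source set demanded by critic row 1187 (B) / 1188 (C) for the P-Z₅ attribution.
-/

noncomputable section

open scoped Classical

open Literature.MathematicalPhysics.StatisticalMechanics Literature.Geometry.DiscreteGeometry
open Summit.AtomisticToContinuum.Crystallization.Theses.PricedLinkCensus
open Summit.AtomisticToContinuum.Crystallization.Theorems.ChargedEnergyGapNegative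

namespace Summit.AtomisticToContinuum.Crystallization.Theorems.ChargedEnergyGapChartDial

/-- ★ Sites chosen within `r` of centres pairwise MORE than `2r` apart are pairwise distinct (general-radius form of
`injective_of_far_centres`). -/
theorem injective_of_separated_centres {ι : Type*} {x c : ι → E3} {r : ℝ} (hx : ∀ i j, i ≠ j → 2 * r < dist (x i) (x j))
    (hc : ∀ i, dist (x i) (c i) ≤ r) : Function.Injective c := by
  intro i j hij
  by_contra hne
  have h1 := hx i j hne
  have h2 : dist (x i) (x j) ≤ dist (x i) (c i) + dist (c i) (x j) := dist_triangle _ _ _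
  have h3 := hc i
  rw [hij, dist_comm (c j) (x j)] at h2
  rw [hij] at h3
  linarith [hc j]

section Blocks

variable {lam ℓ : ℝ} {P : PeriodicConfiguration 3} {C : Set E3}

/-- ★ **SITES NEAR A LEVEL ARE SHELL SITES** (general radius): a point `c` within `r` of a point `q` at a level `L` with
`ϱ/2 + r < L < ϱ − r` has `0 < w_C(c) < 1` (`ϱ > 0`). -/
theorem profileWeight_pos_lt_one_near_level' {ϱ : ℝ} (hϱ : 0 < ϱ) {q c : E3} {L r : ℝ} (hq : Metric.infDist q C = L)
    (hlo : ϱ / 2 + r < L) (hhi : L < ϱ - r) (hd : dist q c ≤ r) : 0 < profileWeight ϱ C c ∧ profileWeight ϱ C c < 1 := by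
  have h1 := abs_infDist_sub_infDist_le (C := C) q c
  rw [abs_le, hq] at h1
  exact ⟨profileWeight_pos_of_lt_infDist hϱ (by linarith [h1.1]), profileWeight_lt_one_of_infDist_lt hϱ (by linarith [h1.2])⟩

/-- ★★ **`k` BLOCKS OF 109 DISTINCT SITES ALONG A SEGMENT**: on a `(lam ≤ 1/3, ℓ ≥ 3)`-labelled reference, if the levels `L₀ + (66/5)·t`
(`t < k`) all lie between `d(z, C)` and `d(y, C)`, there is an injective family `c : Fin k × Fin 109 → E3` of sites, `c (t, m)` within
`619/100` of a point `y + u•(z − y)` (`0 ≤ u ≤ 1`) of the segment at level exactly `L₀ + (66/5)·t` (blocks are disjoint because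
`66/5 > 2·619/100`). -/
theorem exists_blocks_109 (hL : IsLabelledRef lam ℓ P) (hlam : lam ≤ 1 / 3) (hℓ : 3 ≤ ℓ) {y z : E3} {L₀ : ℝ} (k : ℕ)
    (hz : Metric.infDist z C ≤ L₀) (hy : ∀ t : Fin k, L₀ + 66 / 5 * (t : ℕ) ≤ Metric.infDist y C) :
    ∃ c : Fin k × Fin 109 → E3, Function.Injective c ∧ ∀ tm, c tm ∈ P.points ∧ ∃ u : ℝ, 0 ≤ u ∧ u ≤ 1 ∧
      Metric.infDist (y + u • (z - y)) C = L₀ + 66 / 5 * (tm.1 : ℕ) ∧ dist (y + u • (z - y)) (c tm) ≤ 619 / 100 := by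
  have hlev : ∀ t : Fin k, ∃ u : ℝ, 0 ≤ u ∧ u ≤ 1 ∧ Metric.infDist (y + u • (z - y)) C = L₀ + 66 / 5 * (t : ℕ) := fun t =>
    exists_segment_point_infDist_eq (by have h0 : (0 : ℝ) ≤ ((t : ℕ) : ℝ) := Nat.cast_nonneg _; linarith) (hy t)
  choose u hu0 hu1 huL using hlev
  choose f hf hfm using fun t : Fin k => hL.exists_109_near_point hlam hℓ (y + u t • (z - y))
  -- the passage points are pairwise more than `2·619/100` apart
  have hsep : ∀ t t' : Fin k, t ≠ t' → 2 * ((619 : ℝ) / 100) < dist (y + u t • (z - y)) (y + u t' • (z - y)) := by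
    intro t t' htt
    rcases Nat.lt_or_gt_of_ne (fun h : (t : ℕ) = t' => htt (Fin.ext h)) with h | h
    · have h' : ((t : ℕ) : ℝ) + 1 ≤ (t' : ℕ) := by exact_mod_cast h
      have hle : Metric.infDist (y + u t • (z - y)) C + 66 / 5 ≤ Metric.infDist (y + u t' • (z - y)) C := by
        rw [huL t, huL t']; linarith
      linarith [le_dist_of_infDist_add_le hle]
    · have h' : ((t' : ℕ) : ℝ) + 1 ≤ (t : ℕ) := by exact_mod_cast h
      have hle : Metric.infDist (y + u t' • (z - y)) C + 66 / 5 ≤ Metric.infDist (y + u t • (z - y)) C := by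
        rw [huL t, huL t']; linarith
      have := le_dist_of_infDist_add_le hle
      rw [dist_comm] at this
      linarith
  refine ⟨fun tm => f tm.1 tm.2, ?_, fun tm => ⟨((hfm tm.1) tm.2).1, u tm.1, hu0 _, hu1 _, huL _, ((hfm tm.1) tm.2).2⟩⟩
  -- injectivity: across blocks by separation, inside a block by the census
  have hinj : Function.Injective fun tm : Fin k × Fin 109 => f tm.1 tm.2 := by
    rintro ⟨t, m⟩ ⟨t', m'⟩ heq
    by_cases htt : t = t'
    · subst htt
      exact Prod.ext rfl (hf t heq)
    · exfalso
      have h1 := hsep t t' htt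
      have h2 : dist (y + u t • (z - y)) (y + u t' • (z - y)) ≤
          dist (y + u t • (z - y)) (f t m) + dist (f t m) (y + u t' • (z - y)) := dist_triangle _ _ _
      have h3 := ((hfm t) m).2
      have h4 := ((hfm t') m').2
      have heq' : f t m = f t' m' := heq
      rw [heq', dist_comm (f t' m') (y + u t' • (z - y))] at h2
      rw [heq'] at h3
      linarith
  exact hinj

/-- ★★ **THE RECORD «6 × 109»** (`ϱ = 160`, shell `80 < d < 160`): a pair with `d(z, C) ≤ 84` and `153 ≤ d(y, C)` (every bulk source has
`d(y, C) ≥ 160`) carries an injective family of `6 · 109 = 654` sites, the `(t, m)`-th within `619/100` of a segment point at level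
`87 + (66/5)·t ∈ [87, 153]`, ALL of profile weight strictly between `0` and `1` (levels in `(80.81, 159.19)`) — shell or transition
carriers when non-excised, (H)-candidates when excised. -/
theorem exists_654_shell_sites_record (hL : IsLabelledRef lam ℓ P) (hlam : lam ≤ 1 / 3) (hℓ : 3 ≤ ℓ) {y z : E3}
    (hz : Metric.infDist z C ≤ 84) (hy : 153 ≤ Metric.infDist y C) :
    ∃ c : Fin 6 × Fin 109 → E3, Function.Injective c ∧ ∀ tm, c tm ∈ P.points ∧ 0 < profileWeight 160 C (c tm) ∧
      profileWeight 160 C (c tm) < 1 ∧ ∃ u : ℝ, 0 ≤ u ∧ u ≤ 1 ∧ Metric.infDist (y + u • (z - y)) C = 87 + 66 / 5 * (tm.1 : ℕ) ∧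
        dist (y + u • (z - y)) (c tm) ≤ 619 / 100 := by
  have hyt : ∀ t : Fin 6, (87 : ℝ) + 66 / 5 * (t : ℕ) ≤ Metric.infDist y C := fun t => by
    have : ((t : ℕ) : ℝ) ≤ 5 := by exact_mod_cast Nat.lt_succ_iff.1 t.isLt
    linarith
  obtain ⟨c, hc, hcm⟩ := exists_blocks_109 hL hlam hℓ 6 (hz.trans (by norm_num)) hyt
  refine ⟨c, hc, fun tm => ?_⟩
  obtain ⟨hcP, u, hu0, hu1, huL, hd⟩ := hcm tm
  have ht : ((tm.1 : ℕ) : ℝ) ≤ 5 := by exact_mod_cast Nat.lt_succ_iff.1 tm.1.isLt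
  have ht0 : (0 : ℝ) ≤ ((tm.1 : ℕ) : ℝ) := Nat.cast_nonneg _
  have hw := profileWeight_pos_lt_one_near_level' (ϱ := 160) (r := 619 / 100) (by norm_num) huL (by linarith) (by linarith) hd
  exact ⟨hcP, hw.1, hw.2, u, hu0, hu1, huL, hd⟩

/-- The record count and level bookkeeping: `6 · 109 = 654` sites; levels `87, …, 153` inside `(80 + 619/100, 160 − 619/100)`; spacing
`66/5 > 2·619/100`. -/
theorem record_blocks_numerals : Fintype.card (Fin 6 × Fin 109) = 654 ∧ (87 : ℝ) + 66 / 5 * 5 = 153 ∧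
    (160 : ℝ) / 2 + 619 / 100 < 87 ∧ (153 : ℝ) < 160 - 619 / 100 ∧ 2 * ((619 : ℝ) / 100) < 66 / 5 := by
  refine ⟨by simp, by norm_num, by norm_num, by norm_num, by norm_num⟩

end Blocks

end Summit.AtomisticToContinuum.Crystallization.Theorems.ChargedEnergyGapChartDial

end
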